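import Literature.RepresentationTheory.MoeglinVignerasWaldspurger1987.RankOneThetaLiftLineTypeCriterion
import Literature.RepresentationTheory.MoeglinVignerasWaldspurger1987.RankOneThetaDichotomy
import Literature.RepresentationTheory.MoeglinVignerasWaldspurger1987.RankOneThetaLiftTwistRigidityHolds
import Literature.RepresentationTheory.TwistedCoinvariantsConjugate
import Literature.RepresentationTheory.TwistedCoinvariantsTypeTranslation
import Literature.NumberTheory.GelbartRogawski1991.LocalConjugateSection
import HarnessLib

/-!
# The `(U(1), U(2))` theta dichotomy at an ANISOTROPIC PLANE, non-split place: EXACTLY ONE character of the centre has vanishing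
# theta lift (unpinned form of [Liu2021, Lem. D.1 (1)] at `n = 2`)

[MoeglinVignerasWaldspurger1987] C. Mœglin, M.-F. Vignéras, J.-L. Waldspurger, LNM 1291 (1987), Chap. 3 §IV (the theta dichotomy for unitary dual pairs
over a `p`-adic field); [HarrisKudlaSweet1996] Prop. 5.1 (iii), Thm. 6.1 (ε-dichotomy for `U(1)`); [SunZhu2015] Thm. 1.10 (conservation); [Liu2021] App. D
Lem. D.1 (1) («`ω(μ, ε, χ)` is zero iff `E` is a field, `V` is anisotropic and `χ̌ = μ²`»).  Topic `RepresentationTheory/MoeglinVignerasWaldspurger1987`;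
namespace `Literature.RepresentationTheory.MoeglinVignerasWaldspurger1987`.  THEOREMS ONLY (no definition, no named fact, no `sorry`, no instance, no
notation).  Cell hodgecm-mathlib, fan B rung B-IV; `--supports stmt-HodgeConjecture-24832`.

SETTING (★ `RankOneThetaLiftLineTypeCriterion` with `n₂ = 1`): `E/F` quadratic, `δ` (`c δ = −δ`, `δ² = d`), a finite place `v` with `E ⊗_F F_v` a FIELD,
two hermitian LINES `T₁`, `T₂ = a • T₁` (`1 × 1` Gram matrices over `F`, `a ∈ Fˣ`), the PLANE `J = (T₁ ⊕ T₂) ⊗ 1`, a smooth section `s` of the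
metaplectic cover over `ι_v` on `U(J)(F_v)`, and the centre line `J₁` itself (`cZ : U(J₁)(F_v) → U(J)(F_v)`, `z ↦ z·1`).  For a character `χ` of the
compact torus `U(J₁)(F_v) = E_v¹` the theta lift is `Θ_s(χ) = Coinv_χ(ω_s ∘ cZ)`.

MAIN THEOREM **`rankOne_theta_anisotropicPlane_dichotomy`**: if the plane is ANISOTROPIC — in Hilbert-symbol currency `((−1)⁻¹a⁻¹, d)_v = −1`, i.e.
`(−a, d)_v = −1` (★ `LemD1OfPlace.not_isIsotropic_standingData_iff_hilbertSymbol_eq_neg_one`) — then there is a character `χ₀` of `E_v¹` with OPEN kernel such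
that for every unitary continuous `χ`:  `Θ_s(χ) ≠ 0 ⟺ χ ≠ χ₀`.  (At an ISOTROPIC plane every `Θ_s(χ)` is non-zero: ★ `mvw_IV2_rankOne_nonvanishing_of_isotropic_holds`.)
The IDENTIFICATION of `χ₀` with Liu's «`χ̌ = μ²`» depends on the normalisation of the section `s` and is not made here.

PROOF (see-saw on the two lines, all inputs ★ in the tree):
1. ★ `nontrivial_theta_iff_exists_lineType` (n₂ = 1): `Θ_s(χ) ≠ 0 ⟺ ∃ ξ`, `Coinv_ξ(ω_{s₁}) ≠ 0 ∧ Coinv_{χξ⁻¹}(ω_{s₂} ∘ c₂) ≠ 0` (`c₁ = id`, ★ `localCenter_one_eq_id`).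
2. Block 2 moved onto `U(J₁)(F_v)` and the `T₁`-model: `c₂ = scaleInl` (`localCenter_one_eq_scaleInl`) and ★ `scaleTransportSection` (`T₂ = a•T₁`) give a
   section `š₂` over `ι^{T₁}_{a⁻¹δ}` with `ω_{š₂} = ω_{s₂} ∘ c₂`; ★ `exists_conjSection` gives `s̄₂` over `ι^{T₁}_{−a⁻¹δ}` with `ω_{s̄₂} = conj ∘ ω_{š₂} ∘ conj`, so
   by ★ `nontrivial_coinv_iff_inv_of_conj`: `Coinv_{χξ⁻¹}(ω_{s₂} ∘ c₂) ≠ 0 ⟺ Coinv_{ξχ⁻¹}(ω_{s̄₂}) ≠ 0`.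
3. The lines `δ` and `−a⁻¹δ` lie in DIFFERENT classes exactly when the plane is anisotropic; ★ `rankOne_theta_dichotomy` (character route) gives an
   open-kernel `θ` with `dim ω_{s₁}[ξ] + dim ω_{s̄₂}[ξθ] = 1`, i.e. (`nontrivial_coinv_iff_finrank_pos`) `Coinv_ξ(ω_{s₁}) ≠ 0 ⟺ Coinv_{ξθ}(ω_{s̄₂}) = 0`.
4. Hence `Θ_s(χ) = 0 ⟺` the type set `A = {ξ : Coinv_ξ(ω_{s₁}) ≠ 0}` is closed under `ξ ↦ ξ·(χθ)⁻¹`, which by ★ `nontrivial_coinv_iff_mul_of_forall` (finitely many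
   characters per level) means `A` is `(χθ)⁻¹`-PERIODIC, and by the rank `1 × 1` NON-PERIODICITY ★ `nonPeriodic₁₁_holds` (Howe's character formula) `χθ = 1`.
   So `χ₀ = θ⁻¹`.

HONEST SCOPE: this is the structural half of [Liu2021, Lem. D.1 (1)] at `n = 2` (exactly one vanishing centre character at an anisotropic plane, none at an
isotropic one); the printed identification of that character (`χ̌ = μ²` for the splitting `ι_μ`) is NOT proved here.  HC_CM is proved only modulo the
printed citations — the 2 remaining named inputs (hLiu418 = stmt-HodgeConjecture-24832, h413 = 24833) — until rung 0 closes; count-neutral.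

## References
* [MoeglinVignerasWaldspurger1987] LNM 1291 (1987), Chap. 2 II.1 Rem. (6), Remarque; Chap. 3 §IV.2, §IV.4 Théorème principal.
* [HarrisKudlaSweet1996] M. Harris, S. Kudla, W. J. Sweet, J. AMS 9 (1996), Prop. 5.1 (iii), Thm. 6.1, Cor. 4.4.
* [SunZhu2015] B. Sun, C.-B. Zhu, J. AMS 28 (2015), Thm. 1.10.
* [Liu2021] Y. Liu, Camb. J. Math. 9 (2021) = arXiv:2102.11518, App. D Lem. D.1 (1) (p. 125, l. 5229), proof l. 5245.
* [BernsteinZelevinsky1976] I. N. Bernstein, A. V. Zelevinsky, Russian Math. Surveys 31 (1976), §2.1–2.3.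
-/

set_option autoImplicit false

noncomputable section

open NumberField IsDedekindDomain
open scoped TensorProduct Matrix
open Literature.RepresentationTheory.HeisenbergGroup
open Literature.RepresentationTheory.TwistedCoinv
open Literature.NumberTheory.GelbartRogawski1991.UnitaryDualPair.LocalSplitting
open Literature.NumberTheory.GelbartRogawski1991.UnitaryDualPair.LocalSplitting.BlockSum
open Literature.NumberTheory.Automorphic
open Literature.NumberTheory.Automorphic.Liu2021
open Literature.NumberTheory.QuadraticForms

namespace Literature.RepresentationTheory.MoeglinVignerasWaldspurger1987

/-! ## §0 Bookkeeping: coinvariants versus weight spaces; the rank-one centre map is the retyping `scaleInl` -/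

section Generic

variable {K : Type*} [Group K] [TopologicalSpace K] [IsTopologicalGroup K] [CompactSpace K]
  {S : Type*} [AddCommGroup S] [Module ℂ S] (ρ : Representation ℂ K S)

/-- **`Coinv_ξ(ρ) ≠ 0 ⟺ dim ρ[ξ] > 0`** for `ρ` smooth, `ξ` with open kernel and a finite-dimensional weight space (the compact-group dictionary ★
`exists_linearEquiv_weightSpace_coinv`). [cite: BernsteinZelevinsky1976, §2.3] -/
theorem nontrivial_coinv_iff_finrank_pos (hρ : ρ.IsSmooth) (ξ : K →* ℂˣ) (hξ : IsOpen (ξ.ker : Set K))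
    [FiniteDimensional ℂ (weightSpace ρ id (fun k => ((ξ k : ℂˣ) : ℂ)))] :
    Nontrivial (Coinv ρ ξ) ↔ 0 < Module.finrank ℂ (weightSpace ρ id (fun k => ((ξ k : ℂˣ) : ℂ))) := by
  obtain ⟨e, -⟩ := exists_linearEquiv_weightSpace_coinv ρ ξ hρ hξ
  rw [← e.toEquiv.nontrivial_congr, Module.finrank_pos_iff]

end Generic

section Centre

variable {F : Type} [Field F] [NumberField F] (E : Type) [Field E] [NumberField E] [Algebra F E]
  [Algebra.IsQuadraticExtension F E] (c : E ≃ₐ[F] E)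
  (T₁ T₂ : Matrix (Fin 1) (Fin 1) F) (a : Fˣ) (hTT' : T₂ = (a : F) • T₁)
  {J₁ J₂ : Matrix (Fin 1) (Fin 1) E} (hJ₁ : J₁ = T₁.map (algebraMap F E)) (hJ₂ : J₂ = T₂.map (algebraMap F E))
  (hJ₁0 : J₁ 0 0 ≠ 0) (v : HeightOneSpectrum (𝓞 F))

omit [Algebra.IsQuadraticExtension F E] in
include hTT' hJ₁ hJ₂ in
/-- **For rank one, the centre map `U(J₁)(F_v) → U(J₂)(F_v)` (`z ↦ z·1`) IS the retyping `scaleInl`** (`J₂ = a•J₁`): both have the underlying family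
of `z`. [cite: Mok2014, §1 Notation p. 5] [cite: GelbartRogawski1991, §3.1 p. 454] -/
theorem localCenter_one_eq_scaleInl :
    UnitaryGroup.localCenter E c 1 J₂ J₁ hJ₁0 v = scaleInl F E c 1 T₁ T₂ a hTT' hJ₁ hJ₂ v := by
  refine MonoidHom.ext fun z => Subtype.ext ?_
  rw [coe_scaleInl, UnitaryGroup.coe_localCenter]
  -- `localScalarGL E 1 v z = z`: the same family as `localCenter E c 1 J₁ J₁ hJ₁0 v z = z`
  have h := congrArg (fun x : UnitaryGroup.localPi E c 1 J₁ v => (x : UnitaryGroup.LocalGLPi E 1 v))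
    (UnitaryGroup.localCenter_one_apply E c J₁ hJ₁0 v z)
  simpa only [UnitaryGroup.coe_localCenter] using h

end Centre


/-! ## §1 The anisotropic plane: exactly one vanishing centre character -/

section Plane

variable (F : Type) [Field F] [NumberField F] (E : Type) [Field E] [NumberField E] [Algebra F E]
  [Algebra.IsQuadraticExtension F E] (c : E ≃ₐ[F] E) {δ : E} (hcδ : c δ = -δ) (hδ : δ ≠ 0) {d : F}
  (hd : δ * δ = algebraMap F E d) (v : HeightOneSpectrum (𝓞 F))
  {T₁ T₂ : Matrix (Fin 1) (Fin 1) F} (hT₁ : T₁.IsSymm) (hT₂ : T₂.IsSymm) (hT₁d : IsUnit T₁.det) (hT₂d : IsUnit T₂.det)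
  (a : Fˣ) (hTT' : T₂ = (a : F) • T₁)
  {J₁ J₂ : Matrix (Fin 1) (Fin 1) E} (hJ₁ : J₁ = T₁.map (algebraMap F E)) (hJ₂ : J₂ = T₂.map (algebraMap F E))
  {J : Matrix (Fin (1 + 1)) (Fin (1 + 1)) E} (hJ : J = (UnitaryGroup.finSum 1 1 T₁ T₂).map (algebraMap F E))
  (s : UnitaryGroup.localPi E c (1 + 1) J v →* LocalMp F (1 + 1) (UnitaryGroup.finSum 1 1 T₁ T₂) v)
  (hs : ∀ g, MpPsi.proj _ (s g) =
    iota F E c (1 + 1) hcδ hδ hd (UnitaryGroup.finSum 1 1 T₁ T₂) (UnitaryGroup.isSymm_finSum hT₁ hT₂) hJ v g)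
  (hJ₁0 : J₁ 0 0 ≠ 0) (hE : IsField (UnitaryGroup.LocalRing E v))

include hcδ hδ hT₁d hJ₁ hE in
/-- at a non-split place a character of the compact torus `U(J₁)(F_v)` with OPEN kernel is unitary and continuous.
[cite: BernsteinZelevinsky1976, §2.1] -/
theorem unitary_continuous_of_isOpen_ker (ξ : UnitaryGroup.localPi E c 1 J₁ v →* ℂˣ)
    (hξ : IsOpen (ξ.ker : Set (UnitaryGroup.localPi E c 1 J₁ v))) :
    (∀ u, ‖((ξ u : ℂˣ) : ℂ)‖ = 1) ∧ Continuous fun u => ((ξ u : ℂˣ) : ℂ) := by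
  haveI : CompactSpace (UnitaryGroup.localPi E c 1 J₁ v) := compactSpace_localPi_rankOne F E c hcδ hδ hT₁d hJ₁ v hE
  haveI : ξ.ker.Normal := ⟨fun n hn g => by rwa [UnitaryGroup.localPi_one_mul_comm E c J₁ v g n, mul_inv_cancel_right]⟩
  haveI : Finite (UnitaryGroup.localPi E c 1 J₁ v ⧸ ξ.ker) := Subgroup.quotient_finite_of_isOpen ξ.ker hξ
  exact ⟨norm_coe_eq_one_of_le_ker ξ ξ.ker le_rfl, continuous_coe_of_le_ker ξ ξ.ker hξ le_rfl⟩

include hT₁ hT₂ hTT' hJ₁ hJ₂ hJ₁0 in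
/-- **Block 2 read on `U(J₁)(F_v)` in the `T₁`-model**: `ω_{s₂} ∘ c₂ = ω_{š₂}` where `š₂` is the scale transport (`T₂ = a•T₁`) of
`restrictRight s` and `c₂ : U(J₁) → U(J₂)` the rank-one centre map (= `scaleInl`). [cite: MoeglinVignerasWaldspurger1987, Chap. 2 II.1 Rem. (6)]
[cite: GelbartRogawski1991, §3.1 p. 454] -/
theorem omega_block_two_comp_localCenter_eq :
    ((MpPsi.toRep (localSchrodinger F 1 T₂ v)).comp (restrictRight F E c v 1 1 hJ₂ hJ hcδ hδ hd hT₁ hT₂ hT₁d s hs)).comp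
        (UnitaryGroup.localCenter E c 1 J₂ J₁ hJ₁0 v) =
      (MpPsi.toRep (localSchrodinger F 1 T₁ v)).comp
        (scaleTransportSection F E c 1 hcδ hδ hd T₁ T₂ hT₁ hT₂ a hTT' hJ₁ hJ₂ v
          (restrictRight F E c v 1 1 hJ₂ hJ hcδ hδ hd hT₁ hT₂ hT₁d s hs)
          (proj_restrictRight F E c v 1 1 hJ₂ hJ hcδ hδ hd hT₁ hT₂ hT₁d s hs)) := by
  rw [omega_scaleTransportSection, localCenter_one_eq_scaleInl E c T₁ T₂ a hTT' hJ₁ hJ₂ hJ₁0 v]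

include hT₁ hT₂ hTT' hJ₁ hJ₂ in
/-- `ω_{š₂}` is smooth when `ω_s` is (it is `ω_{s₂} ∘ scaleInl`, `scaleInl` continuous). [cite: BernsteinZelevinsky1976, §2.1] -/
theorem isSmooth_omega_scaleTransport_block_two
    (hsm : Representation.IsSmooth ((MpPsi.toRep (localSchrodinger F (1 + 1) (UnitaryGroup.finSum 1 1 T₁ T₂) v)).comp s)) :
    Representation.IsSmooth ((MpPsi.toRep (localSchrodinger F 1 T₁ v)).comp
        (scaleTransportSection F E c 1 hcδ hδ hd T₁ T₂ hT₁ hT₂ a hTT' hJ₁ hJ₂ v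
          (restrictRight F E c v 1 1 hJ₂ hJ hcδ hδ hd hT₁ hT₂ hT₁d s hs)
          (proj_restrictRight F E c v 1 1 hJ₂ hJ hcδ hδ hd hT₁ hT₂ hT₁d s hs))) := by
  rw [omega_scaleTransportSection]
  intro f
  exact (isSmooth_restrictRight F E c v 1 1 hJ₂ hJ hcδ hδ hd hT₁ hT₂ hT₁d s hs hsm f).preimage
    (continuous_scaleInl F E c 1 T₁ T₂ a hTT' hJ₁ hJ₂ v)

omit [Algebra.IsQuadraticExtension F E] in
/-- the kernel of a product of characters contains the intersection of the kernels; hence it is open when those are.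
[cite: BernsteinZelevinsky1976, §2.1] -/
theorem isOpen_ker_mul_of_isOpen (ξ₁ ξ₂ : UnitaryGroup.localPi E c 1 J₁ v →* ℂˣ)
    (h₁ : IsOpen (ξ₁.ker : Set (UnitaryGroup.localPi E c 1 J₁ v))) (h₂ : IsOpen (ξ₂.ker : Set (UnitaryGroup.localPi E c 1 J₁ v))) :
    IsOpen ((ξ₁ * ξ₂).ker : Set (UnitaryGroup.localPi E c 1 J₁ v)) := by
  refine Subgroup.isOpen_mono (H₁ := ξ₁.ker ⊓ ξ₂.ker) (fun k hk => ?_) (h₁.inter h₂)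
  rw [MonoidHom.mem_ker, MonoidHom.mul_apply, (Subgroup.mem_inf.1 hk).1, (Subgroup.mem_inf.1 hk).2, one_mul]

omit [Algebra.IsQuadraticExtension F E] in
/-- the kernel of the inverse character is the kernel. [cite: BernsteinZelevinsky1976, §2.1] -/
theorem isOpen_ker_inv_of_isOpen (ξ : UnitaryGroup.localPi E c 1 J₁ v →* ℂˣ)
    (h : IsOpen (ξ.ker : Set (UnitaryGroup.localPi E c 1 J₁ v))) :
    IsOpen ((ξ⁻¹).ker : Set (UnitaryGroup.localPi E c 1 J₁ v)) := by
  have he : ((ξ⁻¹).ker : Set (UnitaryGroup.localPi E c 1 J₁ v)) = (ξ.ker : Set (UnitaryGroup.localPi E c 1 J₁ v)) := by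
    ext k
    simp only [SetLike.mem_coe, MonoidHom.mem_ker, MonoidHom.inv_apply, inv_eq_one]
  rw [he]
  exact h

include hT₁ hT₂ hT₁d hT₂d a hTT' hJ₁ hJ₂ hJ hs hE in
-- the see-saw assembly: three sections, the dichotomy, the counting — generous budget for the block-currency terms
set_option maxHeartbeats 1600000 in
/-- **THE `(U(1), U(2))` THETA DICHOTOMY AT AN ANISOTROPIC PLANE (non-split place; unpinned form of [Liu2021, Lem. D.1 (1)], `n = 2`).**
For the plane `J = (T₁ ⊕ a•T₁) ⊗ 1` over the local FIELD `E_v` with `(−a⁻¹, d)_v = −1` (⟺ the plane is ANISOTROPIC) and a smooth section `s` over `ι_v`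
on `U(J)(F_v)`, there is a character `χ₀` of the centre `U(J₁)(F_v) = E_v¹` with open kernel such that for every unitary continuous `χ`:
`Θ_s(χ) = Coinv_χ(ω_s ∘ (z ↦ z·1)) ≠ 0 ⟺ χ ≠ χ₀`.  (See-saw over ★ `nontrivial_theta_iff_exists_lineType`, conjugate block ★ `exists_conjSection` +
★ `nontrivial_coinv_iff_inv_of_conj`, ★ `rankOne_theta_dichotomy`, ★ `nontrivial_coinv_iff_mul_of_forall`, ★ `nonPeriodic₁₁_holds`; `χ₀ = θ⁻¹` for the
dichotomy character `θ` of the pair of lines `δ`, `−a⁻¹δ`.)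
[cite: MoeglinVignerasWaldspurger1987, Chap. 3 §IV.4 Théorème principal; §IV.2] [cite: HarrisKudlaSweet1996, Prop. 5.1 (iii), Thm. 6.1]
[cite: Liu2021, App. D Lemma D.1 (1) (p. 125, l. 5229)] -/
theorem rankOne_theta_anisotropicPlane_dichotomy
    (hsm : Representation.IsSmooth ((MpPsi.toRep (localSchrodinger F (1 + 1) (UnitaryGroup.finSum 1 1 T₁ T₂) v)).comp s))
    (hclass : hilbertSymbol (v.adicCompletion F) ((-(a : F)⁻¹ : F) : v.adicCompletion F) ((d : F) : v.adicCompletion F) = -1) :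
    ∃ χ₀ : UnitaryGroup.localPi E c 1 J₁ v →* ℂˣ, IsOpen (χ₀.ker : Set (UnitaryGroup.localPi E c 1 J₁ v)) ∧
      ∀ χ : UnitaryGroup.localPi E c 1 J₁ v →* ℂˣ, (∀ u, ‖((χ u : ℂˣ) : ℂ)‖ = 1) → (Continuous fun u => ((χ u : ℂˣ) : ℂ)) →
        (Nontrivial (Coinv
            (((MpPsi.toRep (localSchrodinger F (1 + 1) (UnitaryGroup.finSum 1 1 T₁ T₂) v)).comp s).comp
              (UnitaryGroup.localCenter E c (1 + 1) J J₁ hJ₁0 v)) χ) ↔ χ ≠ χ₀) := by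
  classical
  haveI : CompactSpace (UnitaryGroup.localPi E c 1 J₁ v) := compactSpace_localPi_rankOne F E c hcδ hδ hT₁d hJ₁ v hE
  have hcomm := UnitaryGroup.localPi_one_mul_comm E c J₁ v
  -- (1) the first block `s₁ = restrictLeft s` over `ι^{T₁}_δ`
  have hs₁ := proj_restrictLeft F E c v 1 1 hJ₁ hJ hcδ hδ hd hT₁ hT₂ hT₂d s hs
  have hsm₁ := isSmooth_restrictLeft F E c v 1 1 hJ₁ hJ hcδ hδ hd hT₁ hT₂ hT₂d s hs hsm
  -- (2) the second block moved to `U(J₁)(F_v)` and the `T₁`-model: `š₂` over `ι^{T₁}_{a⁻¹δ}`, then its conjugate `s̄₂` over `ι^{T₁}_{−a⁻¹δ}`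
  have hs₂ := proj_scaleTransportSection F E c 1 hcδ hδ hd T₁ T₂ hT₁ hT₂ a hTT' hJ₁ hJ₂ v
    (restrictRight F E c v 1 1 hJ₂ hJ hcδ hδ hd hT₁ hT₂ hT₁d s hs) (proj_restrictRight F E c v 1 1 hJ₂ hJ hcδ hδ hd hT₁ hT₂ hT₁d s hs)
  have hsm₂ := isSmooth_omega_scaleTransport_block_two F E c hcδ hδ hd v hT₁ hT₂ hT₁d a hTT' hJ₁ hJ₂ hJ s hs hsm
  obtain ⟨sbar, hsbar, hsbarop⟩ := exists_conjSection F E c 1 (conj_lineDelta hcδ a) (lineDelta_ne_zero hδ a)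
    (lineDelta_mul_self hd a) T₁ hT₁ hJ₁ v _ hs₂
  have hsm₃ := isSmooth_conjSection F E c 1 v _ sbar hsbarop hsm₂
  have hconj := toRep_conjSection_conjSB F E c 1 v _ sbar hsbarop
  -- (3) the dichotomy for the lines `δ` and `−a⁻¹δ` (different classes: `hclass`)
  letI : MeasurableSpace (v.adicCompletion F) := borel _
  haveI : BorelSpace (v.adicCompletion F) := ⟨rfl⟩
  obtain ⟨m, hm⟩ := (isContinuousNontrivial_adeleAddCharAt F v).exists_hasConductorExp
  have hα0 : (-(a : F)⁻¹ : F) ≠ 0 := neg_ne_zero.2 (inv_ne_zero a.ne_zero)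
  have hα : algebraMap F E (((-1 : Fˣ)⁻¹ : Fˣ) : F) * (algebraMap F E ((a⁻¹ : Fˣ) : F) * δ) =
      algebraMap F E (-(a : F)⁻¹) * δ := by
    rw [← mul_assoc, ← map_mul, Units.val_inv_eq_inv_val, Units.val_inv_eq_inv_val, Units.val_neg, Units.val_one, inv_neg, inv_one,
      neg_one_mul]
  obtain ⟨θ, hθo, hdich⟩ := rankOne_theta_dichotomy F E c δ hcδ hδ d hd _ (conj_lineDelta (conj_lineDelta hcδ a) (-1))
    (lineDelta_ne_zero (lineDelta_ne_zero hδ a) (-1)) _ (lineDelta_mul_self (lineDelta_mul_self hd a) (-1)) (-(a : F)⁻¹) hα0 hα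
    T₁ hT₁ hT₁d J₁ hJ₁ v hE _ hs₁ hsm₁ sbar hsbar hsm₃ MeasureTheory.Measure.addHaar m hm hclass
  -- (4) the dichotomy read on coinvariants: `Coinv_ξ(ω_{s₁}) ≠ 0 ⟺ Coinv_{ξθ}(ω_{s̄₂}) = 0` for open-kernel `ξ`
  have hstep : ∀ ξ : UnitaryGroup.localPi E c 1 J₁ v →* ℂˣ, IsOpen (ξ.ker : Set (UnitaryGroup.localPi E c 1 J₁ v)) →
      (Nontrivial (Coinv ((MpPsi.toRep (localSchrodinger F 1 T₁ v)).comp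
          (restrictLeft F E c v 1 1 hJ₁ hJ hcδ hδ hd hT₁ hT₂ hT₂d s hs)) ξ) ↔
        ¬ Nontrivial (Coinv ((MpPsi.toRep (localSchrodinger F 1 T₁ v)).comp sbar) (ξ * θ))) := by
    intro ξ hξ
    have hξθ : IsOpen ((ξ * θ).ker : Set (UnitaryGroup.localPi E c 1 J₁ v)) := isOpen_ker_mul_of_isOpen F E c v ξ θ hξ hθo
    obtain ⟨hξu, hξc⟩ := unitary_continuous_of_isOpen_ker F E c hcδ hδ v hT₁d hJ₁ hE ξ hξ
    obtain ⟨hξθu, hξθc⟩ := unitary_continuous_of_isOpen_ker F E c hcδ hδ v hT₁d hJ₁ hE (ξ * θ) hξθ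
    haveI := (finiteDimensional_weightSpace_rankOne F E c hcδ hδ hd hT₁ hT₁d hJ₁ v hE _ hs₁ hsm₁ ξ hξu hξc).1
    haveI := (finiteDimensional_weightSpace_rankOne F E c (conj_lineDelta (conj_lineDelta hcδ a) (-1))
      (lineDelta_ne_zero (lineDelta_ne_zero hδ a) (-1)) (lineDelta_mul_self (lineDelta_mul_self hd a) (-1)) hT₁ hT₁d hJ₁ v hE
      sbar hsbar hsm₃ (ξ * θ) hξθu hξθc).1
    rw [nontrivial_coinv_iff_finrank_pos _ hsm₁ ξ hξ, nontrivial_coinv_iff_finrank_pos _ hsm₃ (ξ * θ) hξθ]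
    have h1 := hdich ξ hξ
    omega
  -- (5) the criterion: `Θ_s(χ) ≠ 0 ⟺ ∃ ξ` open with `Coinv_ξ(ω_{s₁}) ≠ 0` and `Coinv_{ξ(θχ)⁻¹}(ω_{s₁}) = 0`
  have hcrit : ∀ χ : UnitaryGroup.localPi E c 1 J₁ v →* ℂˣ, (∀ u, ‖((χ u : ℂˣ) : ℂ)‖ = 1) →
      (Continuous fun u => ((χ u : ℂˣ) : ℂ)) →
      (Nontrivial (Coinv
            (((MpPsi.toRep (localSchrodinger F (1 + 1) (UnitaryGroup.finSum 1 1 T₁ T₂) v)).comp s).comp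
              (UnitaryGroup.localCenter E c (1 + 1) J J₁ hJ₁0 v)) χ) ↔
        ∃ ξ : UnitaryGroup.localPi E c 1 J₁ v →* ℂˣ, IsOpen (ξ.ker : Set (UnitaryGroup.localPi E c 1 J₁ v)) ∧
          Nontrivial (Coinv ((MpPsi.toRep (localSchrodinger F 1 T₁ v)).comp
            (restrictLeft F E c v 1 1 hJ₁ hJ hcδ hδ hd hT₁ hT₂ hT₂d s hs)) ξ) ∧
          ¬ Nontrivial (Coinv ((MpPsi.toRep (localSchrodinger F 1 T₁ v)).comp
            (restrictLeft F E c v 1 1 hJ₁ hJ hcδ hδ hd hT₁ hT₂ hT₂d s hs)) (ξ * (θ * χ)⁻¹))) := by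
    intro χ hχu hχc
    have hχo := isOpen_ker_rankOne F E c hcδ hδ hT₁d hJ₁ v hE χ hχc
    have hlo : IsOpen (((θ * χ)⁻¹).ker : Set (UnitaryGroup.localPi E c 1 J₁ v)) :=
      isOpen_ker_inv_of_isOpen F E c v _ (isOpen_ker_mul_of_isOpen F E c v θ χ hθo hχo)
    -- the two-block criterion, with `c₁ = id` and block 2 read in the `T₁`-model
    have crit := nontrivial_theta_iff_exists_lineType F E c hcδ hδ hd v 1 hT₁ hT₂ hT₁d hT₂d hJ₁ hJ₂ hJ s hs hJ₁0 hE hsm χ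
    rw [UnitaryGroup.localCenter_one_eq_id E c J₁ hJ₁0 v, omega_block_two_comp_localCenter_eq F E c hcδ hδ hd v hT₁ hT₂ hT₁d a
      hTT' hJ₁ hJ₂ hJ s hs hJ₁0] at crit
    rw [crit]
    -- pointwise identities in the (commutative) character group
    have e₂ : ∀ ξ : UnitaryGroup.localPi E c 1 J₁ v →* ℂˣ, ξ * (θ * χ)⁻¹ * θ = ξ * χ⁻¹ := fun ξ =>
      MonoidHom.ext fun k => by
        simp only [MonoidHom.inv_apply, MonoidHom.mul_apply]
        rw [mul_inv_rev, ← mul_assoc, inv_mul_cancel_right]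
    have e₁ : ∀ ξ : UnitaryGroup.localPi E c 1 J₁ v →* ℂˣ, (χ * ξ⁻¹)⁻¹ = ξ * χ⁻¹ := fun ξ =>
      MonoidHom.ext fun k => by
        simp only [MonoidHom.inv_apply, MonoidHom.mul_apply]
        rw [mul_inv_rev, inv_inv]
    have hu : ∀ ξ : UnitaryGroup.localPi E c 1 J₁ v →* ℂˣ, (∀ u, ‖((ξ u : ℂˣ) : ℂ)‖ = 1) →
        ∀ k, ‖(((χ * ξ⁻¹) k : ℂˣ) : ℂ)‖ = 1 := fun ξ hξu k => by
      rw [MonoidHom.mul_apply, MonoidHom.inv_apply, Units.val_mul, norm_mul, hχu, Units.val_inv_eq_inv_val, norm_inv, hξu, inv_one,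
        mul_one]
    constructor
    · rintro ⟨ξ, hξo, hξu, -, hP, hN⟩
      refine ⟨ξ, hξo, hP, ?_⟩
      -- block 2: conjugate, then the dichotomy at `ξ (θχ)⁻¹`
      rw [MonoidHom.comp_id] at hN
      rw [nontrivial_coinv_iff_inv_of_conj _ _ hconj (χ * ξ⁻¹) (hu ξ hξu), e₁ ξ] at hN
      rw [hstep _ (isOpen_ker_mul_of_isOpen F E c v ξ _ hξo hlo), not_not, e₂ ξ]
      exact hN
    · rintro ⟨ξ, hξo, hP, hN⟩
      obtain ⟨hξu, hξc⟩ := unitary_continuous_of_isOpen_ker F E c hcδ hδ v hT₁d hJ₁ hE ξ hξo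
      refine ⟨ξ, hξo, hξu, hξc, hP, ?_⟩
      rw [hstep _ (isOpen_ker_mul_of_isOpen F E c v ξ _ hξo hlo), not_not, e₂ ξ] at hN
      rw [MonoidHom.comp_id]
      rw [nontrivial_coinv_iff_inv_of_conj _ _ hconj (χ * ξ⁻¹) (hu ξ hξu), e₁ ξ]
      exact hN
  -- (6) the vanishing character is `θ⁻¹`
  refine ⟨θ⁻¹, isOpen_ker_inv_of_isOpen F E c v θ hθo, fun χ hχu hχc => ?_⟩
  have hχo := isOpen_ker_rankOne F E c hcδ hδ hT₁d hJ₁ v hE χ hχc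
  constructor
  · -- if `Θ_s(χ) ≠ 0` then `χ ≠ θ⁻¹`: at `χ = θ⁻¹` the criterion asks for `ξ` with `Coinv_ξ ≠ 0` and `Coinv_{ξ·1} = 0`
    intro hN hχ
    obtain ⟨ξ, -, hP, hP'⟩ := (hcrit χ hχu hχc).1 hN
    have e : ξ * (θ * χ)⁻¹ = ξ := MonoidHom.ext fun k => by
      rw [hχ]
      simp only [MonoidHom.inv_apply, MonoidHom.mul_apply]
      rw [mul_inv_cancel, inv_one, mul_one]
    rw [e] at hP'
    exact hP' hP
  · -- if `χ ≠ θ⁻¹` then `Θ_s(χ) ≠ 0`: otherwise the type set of `ω_{s₁}` is `(θχ)⁻¹`-periodic, so `(θχ)⁻¹ = 1`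
    intro hne
    by_contra hN
    have hlo : IsOpen (((θ * χ)⁻¹).ker : Set (UnitaryGroup.localPi E c 1 J₁ v)) :=
      isOpen_ker_inv_of_isOpen F E c v _ (isOpen_ker_mul_of_isOpen F E c v θ χ hθo hχo)
    have hall : ∀ ξ : UnitaryGroup.localPi E c 1 J₁ v →* ℂˣ, IsOpen (ξ.ker : Set (UnitaryGroup.localPi E c 1 J₁ v)) →
        Nontrivial (Coinv ((MpPsi.toRep (localSchrodinger F 1 T₁ v)).comp
          (restrictLeft F E c v 1 1 hJ₁ hJ hcδ hδ hd hT₁ hT₂ hT₂d s hs)) ξ) →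
        Nontrivial (Coinv ((MpPsi.toRep (localSchrodinger F 1 T₁ v)).comp
          (restrictLeft F E c v 1 1 hJ₁ hJ hcδ hδ hd hT₁ hT₂ hT₂d s hs)) (ξ * (θ * χ)⁻¹)) := by
      intro ξ hξ hP
      by_contra hP'
      exact hN ((hcrit χ hχu hχc).2 ⟨ξ, hξ, hP, hP'⟩)
    have hper := nontrivial_coinv_iff_mul_of_forall _ hcomm ((θ * χ)⁻¹) hlo hall
    have hone := nonPeriodic₁₁_holds F E c δ hcδ hδ d hd T₁ hT₁ hT₁d J₁ hJ₁ v hE _ hs₁ hsm₁ ((θ * χ)⁻¹) hlo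
      (fun ξ hξu hξc => hper ξ (isOpen_ker_rankOne F E c hcδ hδ hT₁d hJ₁ v hE ξ hξc))
    -- `(θχ)⁻¹ = 1` gives `χ = θ⁻¹`
    refine hne (MonoidHom.ext fun k => ?_)
    have hk := DFunLike.congr_fun hone k
    simp only [MonoidHom.inv_apply, MonoidHom.mul_apply, MonoidHom.one_apply] at hk
    rw [inv_eq_one] at hk
    rw [MonoidHom.inv_apply]
    exact eq_inv_of_mul_eq_one_right hk

end Plane


/-! ## EDITION 2 (append-only) — the same theorem with the Gram matrix of the plane as a VARIABLE (`T = T₁ ⊕ T₂` as a hypothesis),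
so that consumers whose plane is typed with another (propositionally equal) Gram term — e.g. `gram F e (realDiagonal L dV) (TW a′)` of the
rank-2 CM θ-package — can instantiate it after proving a matrix identity (`subst` on the variable). -/

section PlaneOfEq

variable (F : Type) [Field F] [NumberField F] (E : Type) [Field E] [NumberField E] [Algebra F E]
  [Algebra.IsQuadraticExtension F E] (c : E ≃ₐ[F] E) {δ : E} (hcδ : c δ = -δ) (hδ : δ ≠ 0) {d : F}
  (hd : δ * δ = algebraMap F E d) (v : HeightOneSpectrum (𝓞 F))
  {T₁ T₂ : Matrix (Fin 1) (Fin 1) F} (hT₁ : T₁.IsSymm) (hT₂ : T₂.IsSymm) (hT₁d : IsUnit T₁.det) (hT₂d : IsUnit T₂.det)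
  (a : Fˣ) (hTT' : T₂ = (a : F) • T₁)
  {J₁ J₂ : Matrix (Fin 1) (Fin 1) E} (hJ₁ : J₁ = T₁.map (algebraMap F E)) (hJ₂ : J₂ = T₂.map (algebraMap F E))
  {T : Matrix (Fin (1 + 1)) (Fin (1 + 1)) F} (hT : T = UnitaryGroup.finSum 1 1 T₁ T₂) (hTs : T.IsSymm)
  {J : Matrix (Fin (1 + 1)) (Fin (1 + 1)) E} (hJ : J = T.map (algebraMap F E))
  (s : UnitaryGroup.localPi E c (1 + 1) J v →* LocalMp F (1 + 1) T v)
  (hs : ∀ g, MpPsi.proj _ (s g) = iota F E c (1 + 1) hcδ hδ hd T hTs hJ v g)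
  (hJ₁0 : J₁ 0 0 ≠ 0) (hE : IsField (UnitaryGroup.LocalRing E v))

include hT₁ hT₂ hT₁d hT₂d a hTT' hJ₁ hJ₂ hT hJ hs hE in
/-- **The anisotropic-plane dichotomy, Gram matrix as a variable**: same statement as `rankOne_theta_anisotropicPlane_dichotomy` for a plane whose Gram
matrix `T` is GIVEN EQUAL to `T₁ ⊕ T₂` (`hT`), the section `s` and the centre embedding typed with `T` and `J = T ⊗ 1` (`subst hT`, then the original).
[cite: MoeglinVignerasWaldspurger1987, Chap. 3 §IV.4 Théorème principal; §IV.2] [cite: HarrisKudlaSweet1996, Prop. 5.1 (iii), Thm. 6.1]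
[cite: Liu2021, App. D Lemma D.1 (1) (p. 125, l. 5229)] -/
theorem rankOne_theta_anisotropicPlane_dichotomy_of_eq
    (hsm : Representation.IsSmooth ((MpPsi.toRep (localSchrodinger F (1 + 1) T v)).comp s))
    (hclass : hilbertSymbol (v.adicCompletion F) ((-(a : F)⁻¹ : F) : v.adicCompletion F) ((d : F) : v.adicCompletion F) = -1) :
    ∃ χ₀ : UnitaryGroup.localPi E c 1 J₁ v →* ℂˣ, IsOpen (χ₀.ker : Set (UnitaryGroup.localPi E c 1 J₁ v)) ∧
      ∀ χ : UnitaryGroup.localPi E c 1 J₁ v →* ℂˣ, (∀ u, ‖((χ u : ℂˣ) : ℂ)‖ = 1) → (Continuous fun u => ((χ u : ℂˣ) : ℂ)) →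
        (Nontrivial (Coinv
            (((MpPsi.toRep (localSchrodinger F (1 + 1) T v)).comp s).comp
              (UnitaryGroup.localCenter E c (1 + 1) J J₁ hJ₁0 v)) χ) ↔ χ ≠ χ₀) := by
  subst hT
  exact rankOne_theta_anisotropicPlane_dichotomy F E c hcδ hδ hd v hT₁ hT₂ hT₁d hT₂d a hTT' hJ₁ hJ₂ hJ s hs hJ₁0 hE hsm hclass

end PlaneOfEq

end Literature.RepresentationTheory.MoeglinVignerasWaldspurger1987

end
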